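import Summits.Ventures.AbcSig.Levels.N6176P1
import Summits.Ventures.AbcSig.Levels.N6176P2
import Summits.Ventures.AbcSig.Levels.N6176P3
import Summits.Ventures.AbcSig.Levels.N6176P4

/-!
# Venture AbcSig — GENERATED level file, level 6176 (AGGREGATOR of 4 part files)

HONEST FRAMING. As in the part files `N6176<part>.lean`, parts P1, P2, P3, P4 (a MIXED split: parts of
different size-splits of the same generator output landed in the tree at different times; every part carries the orbit
blocks of one contiguous run of orbits of the same certified level file `N6176.engine1.json`,
sha256 `247bd62fc91a86482e9b3f3288b9b38479d6debebfab29d8366cd4377e367c7b`): this file only concatenates the orbit lists and the part summaries into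
`level6176Orbits`, `level6176_wellformed`, `level6176_sieve` (the shapes the row templates consume). The split exists because the
tree's files are ≤ 400 lines and ≤ 200 000 bytes. Union of residual exponents ≥ 7: [7, 13, 23]; orbits not eliminable by
the sieve: none. No Diophantine statement is made here; no claim on ABC or any summit.
-/

namespace Summit.Ventures.AbcSig

/-- All newform orbits of level 6176 (concatenation of the parts, engine order). -/
def level6176Orbits : List OrbitData :=
  level6176OrbitsP1 ++ level6176OrbitsP2 ++ level6176OrbitsP3 ++ level6176OrbitsP4

/-- Every listed entry is at an odd prime not dividing 6176. -/
theorem level6176_wellformed :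
    ∀ o ∈ level6176Orbits, ∀ e ∈ o.coeffs, e.ell.Prime ∧ e.ell ≠ 2 ∧ ¬ e.ell ∣ 6176 := by
  unfold level6176Orbits
  exact List.forall_mem_append.2 ⟨List.forall_mem_append.2 ⟨List.forall_mem_append.2 ⟨level6176_wellformedP1, level6176_wellformedP2⟩, level6176_wellformedP3⟩, level6176_wellformedP4⟩

/-- **Level 6176 summary.** For a prime exponent `n ≥ 7`, every orbit of level 6176 is sieve-eliminated by the
kernel certificates of the part files, except that the row's predicate `X` is assumed for: orbit_6176_1 if n ∈ [7], orbit_6176_6 if n ∈ [13], orbit_6176_7 if n ∈ [7], orbit_6176_8 if n ∈ [7], orbit_6176_9 if n ∈ [23], orbit_6176_12 if n ∈ [7]. -/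
theorem level6176_sieve (n : ℕ) (hn : n.Prime) (hmin : 7 ≤ n) (X : OrbitData → Prop)
    (h_orbit_6176_1 : n ∈ ([7] : List ℕ) → X orbit_6176_1)
    (h_orbit_6176_6 : n ∈ ([13] : List ℕ) → X orbit_6176_6)
    (h_orbit_6176_7 : n ∈ ([7] : List ℕ) → X orbit_6176_7)
    (h_orbit_6176_8 : n ∈ ([7] : List ℕ) → X orbit_6176_8)
    (h_orbit_6176_9 : n ∈ ([23] : List ℕ) → X orbit_6176_9)
    (h_orbit_6176_12 : n ∈ ([7] : List ℕ) → X orbit_6176_12) :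
    ∀ o ∈ level6176Orbits, (∀ e ∈ o.coeffs, e.ell.Prime ∧ e.ell ≠ 2 ∧ ¬ e.ell ∣ 6176) ∧ (o.Eliminated bs04Allowed n ∨ X o) := by
  unfold level6176Orbits
  exact List.forall_mem_append.2 ⟨List.forall_mem_append.2 ⟨List.forall_mem_append.2 ⟨(level6176_sieveP1 n hn hmin X h_orbit_6176_1 h_orbit_6176_6 h_orbit_6176_7 h_orbit_6176_8 h_orbit_6176_9), (level6176_sieveP2 n hn hmin X)⟩, (level6176_sieveP3 n hn hmin X)⟩, (level6176_sieveP4 n hn hmin X h_orbit_6176_12)⟩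

end Summit.Ventures.AbcSig
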